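import Summits.BirchSwinnertonDyer.Rank1Residual.GaloisImage.CongruenceVisibilityTwistedWitness
import HarnessLib

/-!
# Criterion (d) "twisted divisibility": discharging the group-theoretic binders
# (cell `b2b-bsdres`, team n1011, seat p10 GEN 8; proposed row T-VIS3-UC, FILE 2; note
# `HOME/b2b-bsdres-n1011-p10/g8/L41-NOTE.md` §3, skeleton `cells/n1011/skel/T-VIS3-UC.md`)

HONEST FRAMING (cell `b2b-bsdres`, run/shared/lean/b2b/bsd-rank1-residual/, verbatim in every
file): the goal of the cell is to DELETE the COMBINATION-SHAPED residual classes of the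
Birch–Swinnerton-Dyer formula for ALL analytic-rank `≤ 1` elliptic curves over `ℚ` — "full BSD
formula for every rank `≤ 1` curve in class `C`" assembled STRICTLY from published theorems — so
that the rank-`≤ 1` remainder becomes exactly the CONSTRUCTION-SHAPED classes, which are TYPED
(missing-input `Prop`s), NOT attempted. This is not "finishing BSD". Team n1011 (N10 / N11):
research route on the CONSTRUCTION-SHAPED class X4 (§I N11 LOWER half); no claim beyond the stated
classes; nothing is booked; marks UNCHANGED. Theorems only: no definition, no named fact, no
`sorry`. TOOL theorems; they close nothing by themselves.

## What

FILE 1 (`CongruenceVisibilityTwistedWitness.lean`) proves criterion (d) for the explicit-witness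
visibility theorem under four abstract binders on the hard place `v₀`: a normal subgroup
`H ⊴ Γ_{K_{v₀}}` with quotient generated by one element `F` (`hgen`), "`H`-fixed `p`-torsion is
`Γ`-fixed" for both curves (`hfixW`, `hfixW'`), and "the `Γ`-fixed `p`-torsion of `E(K̄_{v₀})` is
rank one" (`hcyc`). This file discharges the two that are pure counting:

* §1 `exists_pow_mul_of_index_eq_prime`: `hgen` from `H.Normal`, `H.index = p` prime and ONE
  element `F ∉ H` (a group of prime order is generated by any non-trivial element — Mathlib
  `mem_powers_of_prime_card`).
* §2 `exists_eq_zsmul_of_natCard_fixedTorsion_eq` (any group acting on any abelian group): `hcyc`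
  from "the fixed `n`-torsion has prime order `p`" (Mathlib `mem_multiples_of_prime_card`).
* §3 `natCard_fixedTorsion_localPoints_eq` — Galois descent: the `Γ_{K_v}`-fixed `p`-torsion of
  `E(K̄_v)` is in bijection with the `p`-torsion of Mathlib's `K_v`-points `(W⁄K_v)(K_v)`
  (`mem_range_toGeomPoints_iff` over the perfect field `K_v`), so `hcyc` follows from the census
  datum `#E(K_v)[p] = p` (`t_v = 3` at `p = 3`; the currency of the T-LOC3L deciders,
  `Nat.card (nsmulAddMonoidHom p).ker`).
* §4 `exists_sha_ne_zero_of_congr_of_twistedDivisible_of_card`: FILE 1's certificate shape with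
  `hgen`/`hcyc` replaced by `H.index = p`, `F ∉ H`, `#E(K_{v₀})[p] = p`.

What remains a binder (records lane / a later file): `hfixW`, `hfixW'` ("`E[p](M) = E[p](K_{v₀})`";
at `p = 3`, `M = ℚ₃(α)` unramified cubic it holds because `μ₃ ⊄ M`, via the Weil pairing) and the
two local certificates (d1) `Q'`, (d2) `Q₁`.

References: [SilvermanAEC2009] VIII.§1–2, X.§4; Mathlib `GroupTheory.SpecificGroups.Cyclic`.
-/

noncomputable section

open scoped Classical

namespace Summit.BirchSwinnertonDyer.Rank1Residual.GaloisImage.TwistedWitness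

open WeierstrassCurve Literature.NumberTheory.EllipticCurves Literature.NumberTheory.GaloisRepresentations
open Field

/-! ## §1 `hgen` from a normal subgroup of prime index -/

section Index

variable {Γ : Type*} [Group Γ]

/-- **A normal subgroup of prime index has cyclic quotient generated by any element outside it**:
every `σ` is `F ^ i * h` with `h ∈ H`. (The quotient has prime order `p = [Γ : H]`, so the image of
`F ∉ H` generates it.) [folklore] -/
theorem exists_pow_mul_of_index_eq_prime (H : Subgroup Γ) [H.Normal] {p : ℕ} [Fact p.Prime]
    (hH : H.index = p) {F : Γ} (hF : F ∉ H) (σ : Γ) :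
    ∃ (i : ℕ) (h : Γ), h ∈ H ∧ σ = F ^ i * h := by
  have hcard : Nat.card (Γ ⧸ H) = p := by rw [← Subgroup.index_eq_card, hH]
  have hF' : (QuotientGroup.mk F : Γ ⧸ H) ≠ 1 := by
    rwa [Ne, QuotientGroup.eq_one_iff]
  obtain ⟨i, hi⟩ := (Submonoid.mem_powers_iff _ _).mp
    (mem_powers_of_prime_card hcard hF' (g' := (QuotientGroup.mk σ : Γ ⧸ H)))
  refine ⟨i, (F ^ i)⁻¹ * σ, ?_, by group⟩
  rw [← QuotientGroup.eq_one_iff, QuotientGroup.mk_mul, QuotientGroup.mk_inv, QuotientGroup.mk_pow,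
    hi, inv_mul_cancel]

end Index

/-! ## §2 `hcyc` from "the fixed `n`-torsion has prime order" -/

section RankOne

variable {Γ A : Type*} [Group Γ] [AddCommGroup A] [DistribMulAction Γ A] {n : ℤ}

/-- **Rank one from prime order.** If the `Γ`-fixed `n`-torsion points of `A` form a set of prime
cardinality `p`, then every fixed `n`-torsion point is an integer multiple of any non-zero one (the
fixed `n`-torsion is a group of prime order, generated by any non-zero element). [folklore] -/
theorem exists_eq_zsmul_of_natCard_fixedTorsion_eq {p : ℕ} [Fact p.Prime]
    (hcard : Nat.card {T : A // n • T = 0 ∧ ∀ σ : Γ, σ • T = T} = p)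
    (T₁ T₂ : A) (h₁ : n • T₁ = 0) (h₂ : n • T₂ = 0) (hf₁ : ∀ σ : Γ, σ • T₁ = T₁)
    (hf₂ : ∀ σ : Γ, σ • T₂ = T₂) (hne : T₁ ≠ 0) : ∃ m : ℤ, T₂ = m • T₁ := by
  -- the fixed `n`-torsion as an additive subgroup
  let S : AddSubgroup A :=
    { carrier := {T : A | n • T = 0 ∧ ∀ σ : Γ, σ • T = T}
      zero_mem' := ⟨smul_zero n, fun σ ↦ smul_zero σ⟩
      add_mem' := fun {a b} ha hb ↦ ⟨by rw [smul_add, ha.1, hb.1, add_zero],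
        fun σ ↦ by rw [smul_add, ha.2 σ, hb.2 σ]⟩
      neg_mem' := fun {a} ha ↦ ⟨by rw [smul_neg, ha.1, neg_zero],
        fun σ ↦ by rw [smul_neg, ha.2 σ]⟩ }
  have hS : Nat.card S = p := hcard
  have hx : (⟨T₁, h₁, hf₁⟩ : S) ≠ 0 := fun h0 ↦ hne (congrArg Subtype.val h0)
  obtain ⟨k, hk⟩ := (AddSubmonoid.mem_multiples_iff _ _).mp
    (mem_multiples_of_prime_card hS hx (g' := (⟨T₂, h₂, hf₂⟩ : S)))
  refine ⟨k, ?_⟩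
  have h := congrArg Subtype.val hk
  simp only [AddSubmonoidClass.coe_nsmul] at h
  rw [← h, natCast_zsmul]

end RankOne

/-! ## §3 Galois descent: fixed torsion of `E(K̄_E)` vs torsion of `(W⁄E)(E)` -/

section Descent

variable {K : Type} [Field K] (W : WeierstrassCurve K) (E : Type) [Field E] [Algebra K E]
  [CharZero E]

/-- The `E`-rational points, read in `E(K̄_E)` through `toGeomPoints` and
`baseChangeGeomPointsEquiv`, are exactly the `Γ_E`-fixed points (Galois descent over the perfect
field `E`, tree `mem_range_toGeomPoints_iff`); restricted to `n`-torsion this is a bijection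
`{R ∈ (W⁄E)(E) | n • R = 0} ≃ {T ∈ E(K̄_E) | n • T = 0, Γ_E-fixed}`, so the two sets have the same
cardinality. Silverman, *AEC*, VIII.§1. [folklore] -/
theorem natCard_fixedTorsion_localPoints_eq (n : ℤ) :
    Nat.card {T : localPoints W E // n • T = 0 ∧ ∀ σ : absoluteGaloisGroup E, σ • T = T} =
      Nat.card {R : (W.baseChange E).toAffine.Point // n • R = 0} := by
  symm
  refine Nat.card_congr ?_
  let ψ : (W.baseChange E).toAffine.Point →+ localPoints W E :=
    (W.baseChangeGeomPointsEquiv E).toAddMonoidHom.comp (toGeomPoints (W.baseChange E))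
  have hψ : ∀ R, ψ R = W.baseChangeGeomPointsEquiv E (toGeomPoints (W.baseChange E) R) := fun R ↦ rfl
  have hψinj : Function.Injective ψ := fun R R' h ↦
    toGeomPoints_injective (W.baseChange E) ((W.baseChangeGeomPointsEquiv E).injective h)
  have hψfix : ∀ R (σ : absoluteGaloisGroup E), σ • ψ R = ψ R := fun R σ ↦
    VisibleWitness.baseChangeGeomPointsEquiv_toGeomPoints_mem_fixedPoints W E R σ
  have hψsurj : ∀ T : localPoints W E, (∀ σ : absoluteGaloisGroup E, σ • T = T) → ∃ R, ψ R = T := by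
    intro T hT
    have hfix : (W.baseChangeGeomPointsEquiv E).symm T ∈
        MulAction.fixedPoints (absoluteGaloisGroup E) (geomPoints (W.baseChange E)) := fun σ ↦ by
      rw [← baseChangeGeomPointsEquiv_symm_smul, hT σ]
    obtain ⟨R, hR⟩ := (mem_range_toGeomPoints_iff (W.baseChange E) _).mpr hfix
    exact ⟨R, by rw [hψ, hR, AddEquiv.apply_symm_apply]⟩
  refine
    { toFun := fun R ↦ ⟨ψ R.1, by rw [← map_zsmul, R.2, map_zero], hψfix R.1⟩
      invFun := fun T ↦ ⟨Classical.choose (hψsurj T.1 T.2.2), hψinj ?_⟩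
      left_inv := fun R ↦ Subtype.ext (hψinj (Classical.choose_spec (hψsurj (ψ R.1) (hψfix R.1))))
      right_inv := fun T ↦ Subtype.ext (Classical.choose_spec (hψsurj T.1 T.2.2)) }
  rw [map_zsmul, Classical.choose_spec (hψsurj T.1 T.2.2), T.2.1, map_zero]

/-- **`hcyc` from the census datum `#E(K_v)[p] = p`.** If Mathlib's `K_v`-points of `W⁄K_v` have
exactly `p` points killed by `p` (`p` prime), the `Γ_{K_v}`-fixed `p`-torsion of `E(K̄_v)` is rank
one in the sense of FILE 1. [folklore] -/
theorem exists_eq_zsmul_of_natCard_ker_nsmul_eq {p : ℕ} [Fact p.Prime]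
    (hcard : Nat.card (nsmulAddMonoidHom p : (W.baseChange E).toAffine.Point →+ _).ker = p)
    (T₁ T₂ : localPoints W E) (h₁ : (p : ℤ) • T₁ = 0) (h₂ : (p : ℤ) • T₂ = 0)
    (hf₁ : ∀ σ : absoluteGaloisGroup E, σ • T₁ = T₁) (hf₂ : ∀ σ : absoluteGaloisGroup E, σ • T₂ = T₂)
    (hne : T₁ ≠ 0) : ∃ m : ℤ, T₂ = m • T₁ := by
  refine exists_eq_zsmul_of_natCard_fixedTorsion_eq (Γ := absoluteGaloisGroup E) (p := p) ?_ T₁ T₂ h₁ h₂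
    hf₁ hf₂ hne
  rw [natCard_fixedTorsion_localPoints_eq W E (p : ℤ)]
  refine Eq.trans (Nat.card_congr (Equiv.subtypeEquivRight fun R ↦ ?_)) hcard
  rw [AddMonoidHom.mem_ker, nsmulAddMonoidHom_apply, natCast_zsmul]

end Descent

/-! ## §4 The certificate shape with the counting binders discharged -/

section Main

open NumberField IsDedekindDomain

variable {K : Type} [Field K] [NumberField K] (W W' : WeierstrassCurve K) [W.IsElliptic]
  [W'.IsElliptic] {p : ℕ} [Fact p.Prime]

/-- **Visibility with a twisted-divisible witness — counted form.** As FILE 1's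
`exists_sha_ne_zero_of_congr_of_twistedDivisible`, with the binders `hgen` and `hcyc` at the
distinguished place `v₀` replaced by: `H ⊴ Γ_{K_{v₀}}` has index `p`, `F ∉ H`, and
`#(W⁄K_{v₀})(K_{v₀})[p] = p` (the `t_{v₀}` datum of the census, in the currency of the T-LOC3L
deciders). Remaining binders at `v₀`: `hfixW`, `hfixW'` (`E[p](M) = E[p](K_{v₀})` for `M = K̄^H`)
and the two local certificates `Q'` (d1), `Q₁` (d2). Over `ℚ`, `p = 3`, `v₀ = 3`, `M = ℚ₃(α)`,
`α³ = α + 1`: the unramified-cubic witness road. [folklore] -/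
theorem exists_sha_ne_zero_of_congr_of_twistedDivisible_of_card (hp2 : p ≠ 2)
    (θ : geomTorsion W' (p : ℤ) ≃+ geomTorsion W (p : ℤ))
    (hθ : ∀ (σ : absoluteGaloisGroup K) (P : geomTorsion W' (p : ℤ)), θ (σ • P) = σ • θ P)
    (S : Finset (HeightOneSpectrum (𝓞 K)))
    (hS : ∀ v : HeightOneSpectrum (𝓞 K), v ∉ S →
      W.HasGoodReductionAt v ∧ W'.HasGoodReductionAt v ∧ (p : 𝓞 K) ∉ v.asIdeal)
    (hfin : Finite W.toAffine.Point) (hcop : (Nat.card W.toAffine.Point).Coprime p)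
    (P : W'.toAffine.Point)
    (hP : P ∉ (zsmulAddGroupHom (p : ℤ) : W'.toAffine.Point →+ W'.toAffine.Point).range)
    (v₀ : HeightOneSpectrum (𝓞 K))
    (hoff : ∀ v ∈ S, v ≠ v₀ →
      (∃ Q : (W'.baseChange (v.adicCompletion K)).toAffine.Point,
        p • Q = WeierstrassCurve.Affine.Point.baseChange (W' := W') K (v.adicCompletion K) P) ∨
      (selmerLocalKer W (v.adicCompletion K) (p : ℤ)).relIndex
        ((selmerLocalKer W' (v.adicCompletion K) (p : ℤ)).map (h1Equiv θ hθ).toAddMonoidHom) = 1)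
    (H : Subgroup (absoluteGaloisGroup (v₀.adicCompletion K))) (hH : H.Normal) (hind : H.index = p)
    (F : absoluteGaloisGroup (v₀.adicCompletion K)) (hF : F ∉ H)
    (hfixW : ∀ T : localPoints W (v₀.adicCompletion K), (p : ℤ) • T = 0 → (∀ h ∈ H, h • T = T) →
      ∀ σ : absoluteGaloisGroup (v₀.adicCompletion K), σ • T = T)
    (hfixW' : ∀ T : localPoints W' (v₀.adicCompletion K), (p : ℤ) • T = 0 → (∀ h ∈ H, h • T = T) →
      ∀ σ : absoluteGaloisGroup (v₀.adicCompletion K), σ • T = T)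
    (hcard : Nat.card (nsmulAddMonoidHom p :
      (W.baseChange (v₀.adicCompletion K)).toAffine.Point →+ _).ker = p)
    (Q' : localPoints W' (v₀.adicCompletion K)) (hQ'H : ∀ h ∈ H, h • Q' = Q')
    (hQ' : (p : ℤ) • Q' = pointsMap W' (v₀.adicCompletion K) (toGeomPoints W' P))
    (Q₁ : localPoints W (v₀.adicCompletion K)) (hQ₁H : ∀ h ∈ H, h • Q₁ = Q₁)
    (hQ₁ : (p : ℤ) • Q₁ ∈ MulAction.fixedPoints (absoluteGaloisGroup (v₀.adicCompletion K))
      (localPoints W (v₀.adicCompletion K)))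
    (hQ₁F : F • Q₁ ≠ Q₁) :
    ∃ c : W.sha, c ≠ 0 ∧ p • c = 0 := by
  haveI : CharZero (v₀.adicCompletion K) := charZero_adicCompletion v₀
  haveI : H.Normal := hH
  exact exists_sha_ne_zero_of_congr_of_twistedDivisible W W' hp2 θ hθ S hS hfin hcop P hP v₀ hoff
    H hH F (exists_pow_mul_of_index_eq_prime H hind hF) hfixW hfixW'
    (exists_eq_zsmul_of_natCard_ker_nsmul_eq W (v₀.adicCompletion K) hcard) Q' hQ'H hQ' Q₁ hQ₁H
    hQ₁ hQ₁F

end Main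

end Summit.BirchSwinnertonDyer.Rank1Residual.GaloisImage.TwistedWitness

end
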